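import Mathlib.Topology.Compactification.OnePoint.Basic
import Mathlib.Analysis.Calculus.IteratedDeriv.Defs
import Mathlib.Analysis.SpecialFunctions.Pow.Real
import Literature.Probability.RandomPlanarGeometry.ChordalCurveFamily
import HarnessLib

/-!
# Ptolemy boundary data of a chordal curve family on explored configurations

Topic `Literature/Probability/RandomPlanarGeometry`; definition item `defn-PtolemyBoundaryData`,
for crux `PtolemyLoewnerRigidity` (stmt-CriticalPhenomena-15265) of route SAWPtolemyBoundary
(card ptolemy-boundary-loewner-rigidity), the habitat of its foreseen continuum half
("AbstractPtolemyRigidity": Ptolemy + rank-one bumps + restriction + Markov ⇒ the Ptolemy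
coordinate of the slit domains flows by Loewner; LSW 2003 §5 read backwards).

## Content

An **explored configuration** of a Dobrushin domain `(D; a, b)` is a pair `(D, p)` with
`p : CurveClass ℂ` an explored initial piece of the chord (`DobrushinDomain.IsPast`: a simple
curve from `a` inside `D ∪ {a}`, or the trivial past `trivPast D` = the constant curve at `a`);
its current domain is `remainingDomain D p` (ChordalCurveFamily), its growth point (tip) is
`p.target`, its target is `b = D.pt 1`. A **hull subdomain** of `(D, p)`
(`DobrushinDomain.IsHullSubdomain D p D'`) is a Dobrushin domain `D' ⊆ D` with the same marked
points agreeing with `D` near the explored piece and near `b` — the Jordan-domain transposition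
of Lawler–Schramm–Werner's hulls `A ∈ 𝒜*` (`ℍ ∖ A` simply connected, `A` away from `0`), so
that `(D', p)` is again a configuration.

`PtolemyBoundaryData P Q` (for a chordal family `P` with domain-Markov extension `Q`,
`ChordalFamily.IsMarkovExtension`) carries, for every configuration `(D, p)`:

* a **boundary coordinate**: the boundary of the configuration — `∂D`, both sides of the slit
  `p`, the tip — is parametrised by the real projective line `OnePoint ℝ = ℝ ∪ {∞}` through
  `β D p : OnePoint ℝ → ℂ` ("boundary point at coordinate `x`"), with `β ∞ = b`, the tip at the
  real coordinate `W D p` (the **driving value**), the two slit sides being the coordinate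
  intervals `[x_L, W]` and `[W, x_R]` (axioms `continuous_β`, `range_β`, `injOn_β`, `slit_β`);
  the inverse `θ D p : ℂ → OnePoint ℝ` is the coordinate of a boundary point ("Ptolemy
  coordinate", normalised `θ(b) = ∞`); cyclic order of boundary points = cyclic order of
  `ℝ ∪ {∞}` (`IsCyclic4`). No prime-end theory is needed: slit sides are told apart by their
  coordinates.
* a **boundary kernel** `Z D p x y > 0` (symmetric) — the germ-free two-point datum
  ("partition function between the boundary points at `x` and `y`", meaningful up to a gauge
  `Z ↦ ℓ(x) ℓ(y) Z`): its gauge-free content is (i) the cross-ratios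
  `crossRatio₁/₂ = d d / (d d)` of the semi-metric `d = Z ^ (-p)` (`pdist`) within one
  configuration and (ii) the **same-endpoint ratios** `Z_{D'} / Z_D` between a configuration and
  its hull subdomains, which the **link axioms** identify with avoidance probabilities of the
  family: `link_chord` — `Z_{(D',p)}(tip, b) = Z_{(D,p)}(tip, b) · Q D p {γ ⊆ closure D'}`
  (LSW 2003: `P[γ ∩ A = ∅ | γ[0,t]]`, there `= h_t'(W_t)^{5/8}`), and `link_pair` — for the
  unexplored configuration and any two boundary points `z, w` at which `D'` agrees with `D`,
  `Z_{D'}(z, w) = Z_D(z, w) · P (D; z, w) {γ ⊆ closure D'}` (restriction, LSW 2003 §3, for every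
  re-marking `(D; z, w)` of the same Jordan domain).

Separate `Prop`s (hypotheses a crux may assume; cf. the style of ChordalCurveFamily):
`IsPtolemaic B p` (Ptolemy's equality `d(s,u) d(t,v) = d(s,t) d(u,v) + d(s,v) d(t,u)` on
cyclic quadruples, i.e. `X₁ + X₂ = 1`, `isPtolemaic_iff`); `IsLinearised B p` (the coordinate IS
a Ptolemy coordinate: `d(x,y) = f(x) f(y) |x - y|`, `d(x,∞) = f(x) g`; it implies `IsPtolemaic`,
proved); `IsRankOne B` (rank-one bump response: `√h` additive along the boundary for shrinking
non-degenerate bumps, `h = escape` = `1 − Z_{D'}/Z_D`, the kernel form of the route's lattice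
crux RankOneBumps); regularity vocabulary: the coordinate change `transfer D p D'` to a hull
subdomain (the abstract `h_t` of LSW 2003 §5), its `jet`s at `W` (`h_t'(W_t), h_t'', h_t'''`),
`IsSmoothTransfer`, `HasNondegenerateJets`, and, relative to the boundary parametrisation of
`D`, `coordOfParam`, `IsSmoothCoordinate`, `HasFiniteOrderTip`.

## Design notes

* Coordinates rather than points index the data because the two sides of the explored slit are
  different boundary points (prime ends) of the remaining domain with the same complex
  coordinate; `b ↦ ∞` is the chordal normalisation (`IsChordalUniformizing`: `φ(∞) = b`), under
  which Loewner's chordal equation and LSW's `h_t` live on `ℝ`.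
* All fields are total; the axioms are guarded by `IsPast` / `IsHullSubdomain` (for other
  arguments the data are junk). Which geometric side of the slit is `[x_L, W]` is the instance's
  choice; `transfer` matches sides by this convention (coherence of the choice across hull
  subdomains is part of what a user's regularity hypotheses on `transfer` express).
* Only gauge-free combinations of `Z` are constrained, and only law-visible ones are linked to
  `(P, Q)`: in an explored configuration the only chord whose law the family provides is
  tip `→ b` (`Q D p`), whence `link_chord`; Jordan subdomains pinched at the tip carry no
  information (their avoidance probability vanishes for SLE-type laws by Blumenthal's 0–1 law),
  so hull subdomains are required to agree with `D` near the whole explored piece. As `Z > 0`,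
  the links make the avoidance probabilities of hull subdomains positive — true for restriction
  families (`Φ_A'(0)^α > 0` for hulls away from the marked points), an obligation for instances.
* Non-vacuity (checked in a scratch file, not shipped): with `P = tipFamily`,
  `Q D p = δ_{const p.target}`, `Z ≡ 1` and explicit parametrisations of all admissible
  configurations (slits traversed forth and back) every field is provable.
* NOT here: the Ptolemy-circle lemma (a Ptolemaic kernel admits a linearising coordinate), the
  covariance of the data under similarities, Loewner's equation for `θ_t`, and the abstract
  rigidity theorem itself (route items); `IsSLELaw`/conformal maps are deliberately absent.

## Sources

G. Lawler, O. Schramm, W. Werner, *Conformal restriction: the chordal case*, J. Amer. Math.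
Soc. 16 (2003) 917–955 (arXiv:math/0209343): §3 (hulls `𝒜*`, `P[K ∩ A = ∅] = Φ_A'(0)^α`,
Prop. 4 and Def. 5 of the arXiv version), §5 (`h_t`, `W_t`, `∂_t a = 2 h_t'(W_t)²`, the
`h_t'(W_t)^α` martingale: Prop. 15 of the arXiv version, the "Prop. 5.3" of the route text), §6
(restriction theorem for SLE₈/₃, `P[γ ∩ A = ∅] = Φ_A'(0)^{5/8}`: Thm 17 of the arXiv version);
L. Ahlfors, *Complex Analysis* (1979), Ch. 3 §3
(cross-ratio; `X₁ + X₂ = 1` for points in cyclic order on a circle = Ptolemy's equality);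
W. Werner, *Lectures on two-dimensional critical percolation* (2007) §3.2 (explored
configurations, domain Markov); T. Kennedy, G. Lawler, *Lattice effects in the scaling limit of
the two-dimensional self-avoiding walk* (2013) (boundary lattice/germ factors, which cross-ratios
and same-endpoint ratios cancel). Mathlib: `OnePoint`, `Function.invFunOn`, `iteratedDeriv`,
`ContDiffOn`, `Real.rpow`; tree: `DobrushinDomain`, `CurveClass`, `remainingDomain`,
`ChordalFamily`, `CurveClass.rangeSubset`, `CurveClass.simple` (no cross-ratio kernel, Ptolemy
or boundary-coordinate notion existed: searched `Ptolem|crossRatio|prime end`).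
-/

noncomputable section

open Set Filter Function MeasureTheory OnePoint
open scoped Topology

namespace Literature.Probability.RandomPlanarGeometry

/-! ### Explored configurations and hull subdomains -/

namespace DobrushinDomain

/-- The **trivial explored past** of `(D; a, b)`: the class of the constant curve at `a = D.pt 0`
(nothing explored; `Q D (trivPast D) = P D` for a Markov extension, `IsMarkovExtension.initial`).
[folklore] -/
def trivPast (D : DobrushinDomain) : CurveClass ℂ :=
  CurveClass.mk (Curve.const (D.pt 0))

/-- The trivial past starts at `a`. [folklore] -/
@[simp] theorem source_trivPast (D : DobrushinDomain) : D.trivPast.source = D.pt 0 := rfl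

/-- The tip of the trivial past is `a`. [folklore] -/
@[simp] theorem target_trivPast (D : DobrushinDomain) : D.trivPast.target = D.pt 0 := rfl

/-- The trace of the trivial past is `{a}`. [folklore] -/
@[simp] theorem range_trivPast (D : DobrushinDomain) : D.trivPast.range = {D.pt 0} := by
  simp [trivPast]

/-- `p` is an **admissible explored past** of `(D; a, b)`: it starts at `a`, stays in `D ∪ {a}`
(so it has not reached `∂D ∖ {a}`, in particular not `b`), and is either the trivial past or the
class of a simple curve (the initial pieces `γ[0, σ]` of a simple boundary-avoiding chord;
Werner 2007 §3.2 (2)). [cite: Werner2007, §3.2] -/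
def IsPast (D : DobrushinDomain) (p : CurveClass ℂ) : Prop :=
  p.source = D.pt 0 ∧ p.range ⊆ insert (D.pt 0) D.carrier ∧ (p = D.trivPast ∨ p ∈ CurveClass.simple)

/-- The trivial past is admissible. [folklore] -/
theorem isPast_trivPast (D : DobrushinDomain) : D.IsPast D.trivPast :=
  ⟨rfl, by simp, Or.inl rfl⟩

/-- `D'` is a **hull subdomain** of the configuration `(D, p)`: a Dobrushin domain inside `D`
with the same marked points `a, b`, which agrees with `D` near the explored piece `p` (base
point, slit and tip) and near the target `b` — i.e. `D'` is `D` with hulls attached to the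
unexplored boundary away from `p` and `b` removed. Transposition to Jordan domains of the hulls
`A ∈ 𝒜*` of Lawler–Schramm–Werner (`A` bounded away from the starting point, `ℍ ∖ A` simply
connected; after exploring, `A ∩ γ[0,t] = ∅`).
[cite: LawlerSchrammWerner2003Restriction, §3 (𝒜*) and §5] -/
structure IsHullSubdomain (D : DobrushinDomain) (p : CurveClass ℂ) (D' : DobrushinDomain) :
    Prop where
  /-- `D' ⊆ D`. -/
  carrier_subset : D'.carrier ⊆ D.carrier
  /-- Same starting point `a`. -/
  pt_zero : D'.pt 0 = D.pt 0
  /-- Same target `b`. -/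
  pt_one : D'.pt 1 = D.pt 1
  /-- The removed part stays away from the explored piece (base point, slit, tip). -/
  disjoint_past : Disjoint p.range (closure (D.carrier \ D'.carrier))
  /-- The removed part stays away from the target. -/
  target_notMem : D.pt 1 ∉ closure (D.carrier \ D'.carrier)

/-- Every configuration is a hull subdomain of itself (nothing removed). [folklore] -/
theorem IsHullSubdomain.refl (D : DobrushinDomain) (p : CurveClass ℂ) : D.IsHullSubdomain p D where
  carrier_subset := Subset.rfl
  pt_zero := rfl
  pt_one := rfl
  disjoint_past := by simp
  target_notMem := by simp

/-- An admissible past of `(D, p)` is an admissible past of every hull subdomain (the explored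
piece lies in `D' ∪ {a}` because the removed part avoids it). [folklore] -/
theorem IsHullSubdomain.isPast {D D' : DobrushinDomain} {p : CurveClass ℂ}
    (h : D.IsHullSubdomain p D') (hp : D.IsPast p) : D'.IsPast p := by
  have htriv : D'.trivPast = D.trivPast := by rw [trivPast, trivPast, h.pt_zero]
  refine ⟨hp.1.trans h.pt_zero.symm, fun z hz => ?_, hp.2.2.imp (fun h' => h'.trans htriv.symm) id⟩
  rcases hp.2.1 hz with hza | hzD
  · rw [h.pt_zero, hza]
    exact mem_insert _ _
  · refine mem_insert_of_mem _ (by_contra fun hzD' => ?_)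
    exact Set.disjoint_left.1 h.disjoint_past hz (subset_closure ⟨hzD, hzD'⟩)

/-- With nothing explored the remaining domain is the whole domain (`a ∉ D` as `D` is open, and
`D` is connected with `b` in its closure). [folklore] -/
theorem remainingDomain_trivPast (D : DobrushinDomain) :
    remainingDomain D D.trivPast = D.carrier := by
  have ha : D.pt 0 ∉ D.carrier := fun h =>
    (Set.ext_iff.1 D.isOpen.inter_frontier_eq (D.pt 0)).1 ⟨h, D.pt_mem_frontier 0⟩
  have hdiff : D.carrier \ D.trivPast.range = D.carrier := by
    rw [range_trivPast, sdiff_singleton_eq_self ha]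
  ext z
  simp only [remainingDomain, mem_setOf_eq, hdiff]
  refine ⟨fun h => h.1, fun hz => ⟨hz, ?_⟩⟩
  rw [D.isConnected.isPreconnected.connectedComponentIn hz]
  exact frontier_subset_closure (D.pt_mem_frontier 1)

end DobrushinDomain

/-! ### Cyclic order on the real projective line -/

/-- Four points of the real projective line `ℝ ∪ {∞}` are **in cyclic order** (pairwise distinct,
met in this order when going once around; `∞` closes the line up into a circle): for finite
points some cyclic rotation is strictly increasing, and `(∞, b, c, d)` is cyclic iff `b < c < d`,
etc. The cyclic quadruples are exactly those for which Ptolemy's relation is an equality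
(Ahlfors 1979, Ch. 3 §3: cross-ratio real and `X₁ + X₂ = 1`). [folklore] -/
def IsCyclic4 : OnePoint ℝ → OnePoint ℝ → OnePoint ℝ → OnePoint ℝ → Prop
  | (a : ℝ), (b : ℝ), (c : ℝ), (d : ℝ) =>
      (a < b ∧ b < c ∧ c < d) ∨ (b < c ∧ c < d ∧ d < a) ∨ (c < d ∧ d < a ∧ a < b) ∨
        (d < a ∧ a < b ∧ b < c)
  | ∞, (b : ℝ), (c : ℝ), (d : ℝ) => b < c ∧ c < d
  | (a : ℝ), ∞, (c : ℝ), (d : ℝ) => c < d ∧ d < a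
  | (a : ℝ), (b : ℝ), ∞, (d : ℝ) => d < a ∧ a < b
  | (a : ℝ), (b : ℝ), (c : ℝ), ∞ => a < b ∧ b < c
  | _, _, _, _ => False

/-- **Ptolemy's equality on the line**: for reals in cyclic order,
`|s−u| |t−v| = |s−t| |u−v| + |s−v| |t−u|` (the product of the "diagonals" is the sum of the
products of "opposite sides"). [folklore] -/
theorem IsCyclic4.ptolemy_abs {s t u v : ℝ} (h : IsCyclic4 s t u v) :
    |s - u| * |t - v| = |s - t| * |u - v| + |s - v| * |t - u| := by
  simp only [IsCyclic4] at h
  rcases h with ⟨h1, h2, h3⟩ | ⟨h1, h2, h3⟩ | ⟨h1, h2, h3⟩ | ⟨h1, h2, h3⟩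
  · rw [abs_of_neg (sub_neg.2 (h1.trans h2)), abs_of_neg (sub_neg.2 (h2.trans h3)),
      abs_of_neg (sub_neg.2 h1), abs_of_neg (sub_neg.2 h3),
      abs_of_neg (sub_neg.2 (h1.trans (h2.trans h3))), abs_of_neg (sub_neg.2 h2)]
    ring
  · rw [abs_of_pos (sub_pos.2 (h2.trans h3)), abs_of_neg (sub_neg.2 (h1.trans h2)),
      abs_of_pos (sub_pos.2 (h1.trans (h2.trans h3))), abs_of_neg (sub_neg.2 h2),
      abs_of_pos (sub_pos.2 h3), abs_of_neg (sub_neg.2 h1)]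
    ring
  · rw [abs_of_pos (sub_pos.2 (h1.trans h2)), abs_of_pos (sub_pos.2 (h1.trans (h2.trans h3))),
      abs_of_neg (sub_neg.2 h3), abs_of_neg (sub_neg.2 h1),
      abs_of_pos (sub_pos.2 h2), abs_of_pos (sub_pos.2 (h2.trans h3))]
    ring
  · rw [abs_of_neg (sub_neg.2 (h2.trans h3)), abs_of_pos (sub_pos.2 (h1.trans h2)),
      abs_of_neg (sub_neg.2 h2), abs_of_pos (sub_pos.2 (h1.trans (h2.trans h3))),
      abs_of_pos (sub_pos.2 h1), abs_of_neg (sub_neg.2 h3)]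
    ring

/-! ### The structure -/

/-- **Ptolemy boundary data** of a chordal curve family `P` with domain-Markov extension `Q`
(route SAWPtolemyBoundary, card ptolemy-boundary-loewner-rigidity): for every explored
configuration `(D, p)` a parametrisation `β D p` of its boundary circle (`∂D`, the two slit
sides, the tip at the real coordinate `W D p`, the target `b` at `∞`) by the real projective
line, and a positive symmetric boundary kernel `Z D p x y` in these coordinates, whose
same-endpoint ratios between a configuration and its hull subdomains ARE the family's avoidance
probabilities (`link_chord`: the conditional probability, given the explored piece, that the
rest of the chord avoids the hull — Lawler–Schramm–Werner's `P[γ ∩ A = ∅ | γ[0,t]] =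
h_t'(W_t)^α` read as a definition of boundary data; `link_pair`: restriction for every chord of
the unexplored domain whose endpoints the hull avoids, `P[K ∩ A = ∅] = Φ_A'(0)^α` likewise).
The gauge-free content of `Z` within one configuration is its cross-ratio datum
(`crossRatio₁`, `crossRatio₂`); Ptolemy's equality, the Ptolemy-coordinate property of `β⁻¹`,
the rank-one bump law and regularity are the separate `Prop`s below. See the module docstring
for the design (coordinates instead of prime ends; guards; what is not encoded).
[cite: LawlerSchrammWerner2003Restriction, §3 (Prop. 4, Def. 5 of the arXiv version), §5–6 (h_t, W_t)] -/
structure PtolemyBoundaryData (P : ChordalFamily)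
    (Q : DobrushinDomain → CurveClass ℂ → Measure (CurveClass ℂ)) where
  /-- Boundary point of the configuration `(D, p)` at coordinate `x ∈ ℝ ∪ {∞}`. -/
  β : DobrushinDomain → CurveClass ℂ → OnePoint ℝ → ℂ
  /-- Driving value: the (real) coordinate of the tip `p.target`. -/
  W : DobrushinDomain → CurveClass ℂ → ℝ
  /-- Boundary kernel of `(D, p)` between the boundary points at coordinates `x`, `y`. -/
  Z : DobrushinDomain → CurveClass ℂ → OnePoint ℝ → OnePoint ℝ → ℝ
  /-- The kernel is positive (junk on the diagonal included). -/
  Z_pos : ∀ D p x y, 0 < Z D p x y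
  /-- The kernel is symmetric. -/
  Z_symm : ∀ D p x y, Z D p x y = Z D p y x
  /-- The boundary parametrisation is continuous on `ℝ ∪ {∞}`. -/
  continuous_β : ∀ D p, D.IsPast p → Continuous (β D p)
  /-- The target `b` sits at `∞`. -/
  β_infty : ∀ D p, D.IsPast p → β D p ∞ = D.pt 1
  /-- The parametrisation traces exactly `∂D` and the explored slit. -/
  range_β : ∀ D p, D.IsPast p → range (β D p) = frontier D.carrier ∪ p.range
  /-- Each point of `∂D` other than the base point `a` has exactly one coordinate. -/
  injOn_β : ∀ D p, D.IsPast p → InjOn (β D p) (β D p ⁻¹' (frontier D.carrier \ {D.pt 0}))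
  /-- The tip sits at the driving value. -/
  β_W : ∀ D p, D.IsPast p → β D p (W D p) = p.target
  /-- The slit occupies a coordinate interval `[x_L, x_R] ∋ W`, each side `[x_L, W]`, `[W, x_R]`
  running once between the base point `a` and the tip. -/
  slit_β : ∀ D p, D.IsPast p → ∃ xL xR : ℝ, xL ≤ W D p ∧ W D p ≤ xR ∧
    (fun x : ℝ => β D p x) ⁻¹' p.range = Icc xL xR ∧ β D p xL = D.pt 0 ∧ β D p xR = D.pt 0 ∧
    InjOn (fun x : ℝ => β D p x) (Icc xL (W D p)) ∧ InjOn (fun x : ℝ => β D p x) (Icc (W D p) xR)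
  /-- Restriction link, unexplored level: for a hull subdomain `D'` of `(D, trivPast)` and two
  boundary points `z = E.pt 0`, `w = E.pt 1` of `D` (any re-marking `E` of the same domain) near
  which `D'` agrees with `D`, `Z_{D'}(z, w) = Z_D(z, w) · P (D; z, w) {γ ⊆ closure D'}`. -/
  link_pair : ∀ (D D' E : DobrushinDomain) (x y x' y' : OnePoint ℝ),
    D.IsHullSubdomain D.trivPast D' → E.carrier = D.carrier →
    β D D.trivPast x = E.pt 0 → β D D.trivPast y = E.pt 1 →
    β D' D'.trivPast x' = E.pt 0 → β D' D'.trivPast y' = E.pt 1 →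
    E.pt 0 ∉ closure (D.carrier \ D'.carrier) → E.pt 1 ∉ closure (D.carrier \ D'.carrier) →
      Z D' D'.trivPast x' y' =
        Z D D.trivPast x y * (P E (CurveClass.rangeSubset (closure D'.carrier))).toReal
  /-- Restriction–Markov link, explored level: for a hull subdomain `D'` of `(D, p)`,
  `Z_{(D',p)}(tip, b) = Z_{(D,p)}(tip, b) · Q D p {γ ⊆ closure D'}`. -/
  link_chord : ∀ (D : DobrushinDomain) (p : CurveClass ℂ) (D' : DobrushinDomain),
    D.IsPast p → D.IsHullSubdomain p D' →
      Z D' p (W D' p) ∞ =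
        Z D p (W D p) ∞ * (Q D p (CurveClass.rangeSubset (closure D'.carrier))).toReal

namespace PtolemyBoundaryData

variable {P : ChordalFamily} {Q : DobrushinDomain → CurveClass ℂ → Measure (CurveClass ℂ)}
  (B : PtolemyBoundaryData P Q)

/-! ### Kernel, semi-metric and cross-ratios -/

/-- The real section `x ↦ β(x)` of the boundary parametrisation (the boundary minus `b`).
[folklore] -/
def βr (D : DobrushinDomain) (p : CurveClass ℂ) (x : ℝ) : ℂ :=
  B.β D p x

/-- The **semi-metric** `d = Z ^ (-p)` of exponent `p > 0` induced by the kernel (on the lattice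
`p = 1/(2b)`, `b` the boundary scaling exponent; `d(x,y) = f(x) f(y) |θx − θy|` is the Ptolemaic
case). [folklore] -/
def pdist (pexp : ℝ) (D : DobrushinDomain) (p : CurveClass ℂ) (x y : OnePoint ℝ) : ℝ :=
  B.Z D p x y ^ (-pexp)

/-- The semi-metric is positive. [folklore] -/
theorem pdist_pos (pexp : ℝ) (D : DobrushinDomain) (p : CurveClass ℂ) (x y : OnePoint ℝ) :
    0 < B.pdist pexp D p x y :=
  Real.rpow_pos_of_pos (B.Z_pos D p x y) _

/-- The semi-metric is symmetric. [folklore] -/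
theorem pdist_comm (pexp : ℝ) (D : DobrushinDomain) (p : CurveClass ℂ) (x y : OnePoint ℝ) :
    B.pdist pexp D p x y = B.pdist pexp D p y x := by
  rw [pdist, pdist, B.Z_symm]

/-- First **cross-ratio** of a quadruple, `X₁ = d(s,t) d(u,v) / (d(s,u) d(t,v))` (for the lattice
data: `(Z_su Z_tv / (Z_st Z_uv)) ^ p`, the quantity of crux BoundaryPtolemy; for points on a line
this is Cardy's `crossRatio`). [cite: Ahlfors1979, Ch. 3 §3] -/
def crossRatio₁ (pexp : ℝ) (D : DobrushinDomain) (p : CurveClass ℂ) (s t u v : OnePoint ℝ) : ℝ :=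
  B.pdist pexp D p s t * B.pdist pexp D p u v / (B.pdist pexp D p s u * B.pdist pexp D p t v)

/-- Second **cross-ratio** of a quadruple, `X₂ = d(s,v) d(t,u) / (d(s,u) d(t,v))`.
[cite: Ahlfors1979, Ch. 3 §3] -/
def crossRatio₂ (pexp : ℝ) (D : DobrushinDomain) (p : CurveClass ℂ) (s t u v : OnePoint ℝ) : ℝ :=
  B.pdist pexp D p s v * B.pdist pexp D p t u / (B.pdist pexp D p s u * B.pdist pexp D p t v)

/-- Cross-ratios are positive (the datum lives in `(0, ∞)`). [folklore] -/
theorem crossRatio₁_pos (pexp : ℝ) (D : DobrushinDomain) (p : CurveClass ℂ) (s t u v : OnePoint ℝ) :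
    0 < B.crossRatio₁ pexp D p s t u v :=
  div_pos (mul_pos (B.pdist_pos _ _ _ _ _) (B.pdist_pos _ _ _ _ _))
    (mul_pos (B.pdist_pos _ _ _ _ _) (B.pdist_pos _ _ _ _ _))

/-- The second cross-ratio is positive. [folklore] -/
theorem crossRatio₂_pos (pexp : ℝ) (D : DobrushinDomain) (p : CurveClass ℂ) (s t u v : OnePoint ℝ) :
    0 < B.crossRatio₂ pexp D p s t u v :=
  div_pos (mul_pos (B.pdist_pos _ _ _ _ _) (B.pdist_pos _ _ _ _ _))
    (mul_pos (B.pdist_pos _ _ _ _ _) (B.pdist_pos _ _ _ _ _))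

/-- The data are **Ptolemaic with exponent `p`**: in every admissible configuration the
semi-metric `d = Z ^ (-p)` satisfies Ptolemy's EQUALITY
`d(s,u) d(t,v) = d(s,t) d(u,v) + d(s,v) d(t,u)` for all cyclic quadruples of boundary
coordinates (`∞ = b` included) — "the boundary is a Ptolemy circle": one conformal modulus per
quadruple, not two (card K1 / crux BoundaryPtolemy in the limit). [folklore] -/
def IsPtolemaic (pexp : ℝ) : Prop :=
  ∀ (D : DobrushinDomain) (p : CurveClass ℂ), D.IsPast p → ∀ s t u v : OnePoint ℝ,
    IsCyclic4 s t u v →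
      B.pdist pexp D p s u * B.pdist pexp D p t v =
        B.pdist pexp D p s t * B.pdist pexp D p u v + B.pdist pexp D p s v * B.pdist pexp D p t u

/-- Ptolemy's equality in cross-ratio form: `X₁ + X₂ = 1` on cyclic quadruples. [folklore] -/
theorem isPtolemaic_iff (pexp : ℝ) :
    B.IsPtolemaic pexp ↔ ∀ (D : DobrushinDomain) (p : CurveClass ℂ), D.IsPast p →
      ∀ s t u v : OnePoint ℝ, IsCyclic4 s t u v →
        B.crossRatio₁ pexp D p s t u v + B.crossRatio₂ pexp D p s t u v = 1 := by
  refine forall₃_congr fun D p _ => forall₄_congr fun s t u v => forall_congr' fun _ => ?_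
  rw [crossRatio₁, crossRatio₂, ← add_div,
    div_eq_one_iff_eq (mul_pos (B.pdist_pos _ _ _ _ _) (B.pdist_pos _ _ _ _ _)).ne', eq_comm]

/-- The data are **linearised with exponent `p`**: in every admissible configuration the
boundary coordinate is a PTOLEMY COORDINATE for `d = Z ^ (-p)`, i.e. there are a gauge
`f > 0` on `ℝ` and `g > 0` with `d(x, y) = f(x) f(y) |x − y|` for real `x ≠ y` and
`d(x, ∞) = f(x) g` (the boundary semi-metric is that of points on a line, up to gauge; for a
conformally covariant restriction family `θ = φ|∂D`, `f = |φ'|^{-1/2}` in boundary-smooth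
charts). This is the form in which the route's device uses hypothesis (P). [folklore] -/
def IsLinearised (pexp : ℝ) : Prop :=
  ∀ (D : DobrushinDomain) (p : CurveClass ℂ), D.IsPast p → ∃ (f : ℝ → ℝ) (g : ℝ),
    (∀ x, 0 < f x) ∧ 0 < g ∧
    (∀ x y : ℝ, x ≠ y → B.pdist pexp D p x y = f x * f y * |x - y|) ∧
    ∀ x : ℝ, B.pdist pexp D p x ∞ = f x * g

/-- A linearised kernel is Ptolemaic (Ptolemy's equality for points of a line in cyclic order,
`IsCyclic4.ptolemy_abs`, multiplied by the gauge). [folklore] -/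
theorem IsLinearised.isPtolemaic {B : PtolemyBoundaryData P Q} {pexp : ℝ}
    (h : B.IsLinearised pexp) : B.IsPtolemaic pexp := by
  intro D p hp s t u v hc
  obtain ⟨f, g, -, -, h1, h2⟩ := h D p hp
  have h2' : ∀ x : ℝ, B.pdist pexp D p ∞ x = f x * g := fun x => by rw [pdist_comm]; exact h2 x
  induction s using OnePoint.rec <;> induction t using OnePoint.rec <;>
    induction u using OnePoint.rec <;> induction v using OnePoint.rec <;>
    first | (simp only [IsCyclic4] at hc; done) | skip
  · rename_i t u v
    simp only [IsCyclic4] at hc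
    obtain ⟨htu, huv⟩ := hc
    rw [h2' u, h1 t v (htu.trans huv).ne, h2' t, h1 u v huv.ne, h2' v, h1 t u htu.ne,
      abs_of_neg (sub_neg.2 (htu.trans huv)), abs_of_neg (sub_neg.2 huv),
      abs_of_neg (sub_neg.2 htu)]
    ring
  · rename_i s u v
    simp only [IsCyclic4] at hc
    obtain ⟨huv, hvs⟩ := hc
    rw [h1 s u (huv.trans hvs).ne', h2' v, h2 s, h1 u v huv.ne, h1 s v hvs.ne', h2' u,
      abs_of_pos (sub_pos.2 (huv.trans hvs)), abs_of_neg (sub_neg.2 huv),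
      abs_of_pos (sub_pos.2 hvs)]
    ring
  · rename_i s t v
    simp only [IsCyclic4] at hc
    obtain ⟨hvs, hst⟩ := hc
    rw [h2 s, h1 t v (hvs.trans hst).ne', h1 s t hst.ne, h2' v, h1 s v hvs.ne', h2 t,
      abs_of_pos (sub_pos.2 (hvs.trans hst)), abs_of_neg (sub_neg.2 hst),
      abs_of_pos (sub_pos.2 hvs)]
    ring
  · rename_i s t u
    simp only [IsCyclic4] at hc
    obtain ⟨hst, htu⟩ := hc
    rw [h1 s u (hst.trans htu).ne, h2 t, h1 s t hst.ne, h2 u, h2 s, h1 t u htu.ne,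
      abs_of_neg (sub_neg.2 (hst.trans htu)), abs_of_neg (sub_neg.2 hst),
      abs_of_neg (sub_neg.2 htu)]
    ring
  · rename_i s t u v
    have key := hc.ptolemy_abs
    simp only [IsCyclic4] at hc
    rcases hc with h | h | h | h
    · rw [h1 s u (h.1.trans h.2.1).ne, h1 t v (h.2.1.trans h.2.2).ne, h1 s t h.1.ne,
        h1 u v h.2.2.ne, h1 s v (h.1.trans (h.2.1.trans h.2.2)).ne, h1 t u h.2.1.ne]
      linear_combination (f s * f t * f u * f v) * key
    · rw [h1 s u (h.2.1.trans h.2.2).ne', h1 t v (h.1.trans h.2.1).ne,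
        h1 s t (h.1.trans (h.2.1.trans h.2.2)).ne', h1 u v h.2.1.ne, h1 s v h.2.2.ne',
        h1 t u h.1.ne]
      linear_combination (f s * f t * f u * f v) * key
    · rw [h1 s u (h.1.trans h.2.1).ne', h1 t v (h.2.1.trans h.2.2).ne', h1 s t h.2.2.ne,
        h1 u v h.1.ne, h1 s v h.2.1.ne', h1 t u (h.1.trans (h.2.1.trans h.2.2)).ne']
      linear_combination (f s * f t * f u * f v) * key
    · rw [h1 s u (h.2.1.trans h.2.2).ne, h1 t v (h.1.trans h.2.1).ne', h1 s t h.2.1.ne,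
        h1 u v (h.1.trans (h.2.1.trans h.2.2)).ne', h1 s v h.1.ne', h1 t u h.2.2.ne]
      linear_combination (f s * f t * f u * f v) * key

/-! ### The Ptolemy coordinate and the coordinate change to a hull subdomain -/

/-- The **Ptolemy coordinate** `θ_{D,p} : boundary → ℝ ∪ {∞}` of the configuration `(D, p)`:
the coordinate of a boundary point (inverse of `β`; `θ(b) = ∞`, `θ(tip) = W`; for a point of the
open slit, which has two coordinates, one of them; junk off the boundary). [folklore] -/
def θ (D : DobrushinDomain) (p : CurveClass ℂ) (z : ℂ) : OnePoint ℝ :=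
  invFunOn (B.β D p) univ z

/-- `β ∘ θ = id` on the boundary of an admissible configuration. [folklore] -/
theorem β_θ {D : DobrushinDomain} {p : CurveClass ℂ} (hp : D.IsPast p) {z : ℂ}
    (hz : z ∈ frontier D.carrier ∪ p.range) : B.β D p (B.θ D p z) = z := by
  rw [← B.range_β D p hp] at hz
  obtain ⟨x, rfl⟩ := hz
  exact invFunOn_eq (f := B.β D p) ⟨x, mem_univ _, rfl⟩

/-- `θ ∘ β = id` at coordinates of points of `∂D ∖ {a}` (which have exactly one coordinate).
[folklore] -/
theorem θ_β {D : DobrushinDomain} {p : CurveClass ℂ} (hp : D.IsPast p) {x : OnePoint ℝ}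
    (hx : B.β D p x ∈ frontier D.carrier \ {D.pt 0}) : B.θ D p (B.β D p x) = x := by
  have hex : ∃ a ∈ (univ : Set (OnePoint ℝ)), B.β D p a = B.β D p x := ⟨x, mem_univ _, rfl⟩
  have h1 : B.β D p (B.θ D p (B.β D p x)) = B.β D p x := invFunOn_eq hex
  exact B.injOn_β D p hp (show B.θ D p (B.β D p x) ∈ _ by rw [mem_preimage, h1]; exact hx) hx h1

open Classical in
/-- The **coordinate change** from the configuration `(D, p)` to its hull subdomain `(D', p)` on
real coordinates (the abstract counterpart of Lawler–Schramm–Werner's `h_t = g̃_t ∘ Φ_A ∘ g_t⁻¹`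
on `ℝ`): the coordinate in `(D', p)` of the boundary point `β D p x`, on the same slit side
(`≤ W ↦ ≤ W'`, `≥ W ↦ ≥ W'`) when that point lies on the explored slit. Meaningful at coordinates
whose boundary point is untouched by the removed hulls; junk elsewhere.
[cite: LawlerSchrammWerner2003Restriction, §5 (h_t)] -/
def transferAux (D : DobrushinDomain) (p : CurveClass ℂ) (D' : DobrushinDomain) (x : ℝ) : ℝ :=
  if B.β D p x ∈ p.range then
    (if x ≤ B.W D p then invFunOn (B.βr D' p) (Iic (B.W D' p)) (B.β D p x)
      else invFunOn (B.βr D' p) (Ici (B.W D' p)) (B.β D p x))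
  else invFunOn (B.βr D' p) univ (B.β D p x)

/-- The coordinate change to a hull subdomain on `ℝ ∪ {∞}` (`∞ ↦ ∞`: the target is common).
[cite: LawlerSchrammWerner2003Restriction, §5 (h_t)] -/
def transfer (D : DobrushinDomain) (p : CurveClass ℂ) (D' : DobrushinDomain) :
    OnePoint ℝ → OnePoint ℝ
  | ∞ => ∞
  | (x : ℝ) => (B.transferAux D p D' x : OnePoint ℝ)

/-- The coordinate change maps the driving value to the driving value (`h_t(W_t) = W̃_t`).
[cite: LawlerSchrammWerner2003Restriction, §5] -/
theorem transferAux_W {D D' : DobrushinDomain} {p : CurveClass ℂ} (hp : D.IsPast p)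
    (h : D.IsHullSubdomain p D') : B.transferAux D p D' (B.W D p) = B.W D' p := by
  have hp' := h.isPast hp
  have htip : B.β D p (B.W D p) ∈ p.range := by
    rw [B.β_W D p hp]
    exact p.target_mem_range
  simp only [transferAux, htip, if_true, le_refl]
  rw [B.β_W D p hp]
  have hex : ∃ x ∈ Iic (B.W D' p), B.βr D' p x = p.target := ⟨_, self_mem_Iic, B.β_W D' p hp'⟩
  obtain ⟨xL, xR, hL, -, hpre, -, -, hinjL, -⟩ := B.slit_β D' p hp'
  have h1 : B.βr D' p (invFunOn (B.βr D' p) (Iic (B.W D' p)) p.target) = p.target :=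
    invFunOn_eq hex
  have h2 : invFunOn (B.βr D' p) (Iic (B.W D' p)) p.target ≤ B.W D' p := invFunOn_mem hex
  have h3 : invFunOn (B.βr D' p) (Iic (B.W D' p)) p.target ∈ Icc xL xR := by
    rw [← hpre, mem_preimage]
    change B.βr D' p _ ∈ p.range
    rw [h1]
    exact p.target_mem_range
  exact hinjL ⟨h3.1, h2⟩ ⟨hL, le_rfl⟩ (h1.trans (B.β_W D' p hp').symm)

/-- The **escape datum** `h(x, y) = 1 − Z_{(D',p)}(x', y') / Z_{(D,p)}(x, y)` of the chord
between the boundary points at coordinates `x, y` with respect to the hull subdomain `D'`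
(`x', y'` the transferred coordinates): by the link axioms, the probability that this chord
LEAVES `closure D'`, i.e. hits the removed hulls (`1 − Φ_A'(0)^α`-type quantity), wherever the
family provides that chord's law (`escape_chord`). [cite: LawlerSchrammWerner2003Restriction, §3] -/
def escape (D : DobrushinDomain) (p : CurveClass ℂ) (D' : DobrushinDomain) (x y : OnePoint ℝ) : ℝ :=
  1 - B.Z D' p (B.transfer D p D' x) (B.transfer D p D' y) / B.Z D p x y

/-- The escape datum of the chord tip `→ b` of an explored configuration is the conditional
probability, given the explored piece, that the rest of the curve leaves `closure D'`
(from `link_chord`). [cite: LawlerSchrammWerner2003Restriction, §5–6] -/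
theorem escape_chord {D D' : DobrushinDomain} {p : CurveClass ℂ} (hp : D.IsPast p)
    (h : D.IsHullSubdomain p D') :
    B.escape D p D' (B.W D p) ∞ =
      1 - (Q D p (CurveClass.rangeSubset (closure D'.carrier))).toReal := by
  simp only [escape, transfer, B.transferAux_W hp h]
  rw [B.link_chord D p D' hp h, mul_div_cancel_left₀ _ (B.Z_pos _ _ _ _).ne']

/-! ### Rank-one bump response -/

/-- The data have **rank-one bump response** (hypothesis (L) of the card; the kernel form of
crux RankOneBumps): in every admissible configuration, for boundary coordinates `u, v, w` and a
real coordinate `ξ` in cyclic order `(u, v, w, ξ)`, every non-degeneracy `ϑ ∈ (0, 1]` and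
`η > 0`, there is `ε₀ > 0` such that for every hull subdomain `D'` obtained by removing a bump
inside `B(β ξ, ε)` containing `D ∩ B(β ξ, ϑ ε)`, `ε < ε₀`, the escape data satisfy
`|√h(u,w) − √h(u,v) − √h(v,w)| ≤ η √h(u,w)` — `√h` is additive along the boundary, i.e. the
response to an infinitesimal bump has rank one. For the restriction measures `P_α` this holds
exactly to first order: `P[(u,w)-chord hits a small hull at ξ] ≈ α · hcap · (1/(ξ−u) − 1/(ξ−w))²`
from `P[K ∩ A = ∅] = Φ_A'(0)^α` and Möbius covariance.
[cite: LawlerSchrammWerner2003Restriction, §3 (Prop. 4 of the arXiv version)] -/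
def IsRankOne (B : PtolemyBoundaryData P Q) : Prop :=
  ∀ (D : DobrushinDomain) (p : CurveClass ℂ), D.IsPast p →
    ∀ (u v w : OnePoint ℝ) (ξ : ℝ), IsCyclic4 u v w ξ →
    ∀ ϑ : ℝ, 0 < ϑ → ϑ ≤ 1 → ∀ η : ℝ, 0 < η → ∃ ε₀ : ℝ, 0 < ε₀ ∧
      ∀ (D' : DobrushinDomain) (ε : ℝ), 0 < ε → ε < ε₀ → D.IsHullSubdomain p D' →
        D.carrier \ D'.carrier ⊆ Metric.ball (B.β D p ξ) ε →
        D.carrier ∩ Metric.ball (B.β D p ξ) (ϑ * ε) ⊆ D.carrier \ D'.carrier →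
          |Real.sqrt (B.escape D p D' u w) - Real.sqrt (B.escape D p D' u v) -
              Real.sqrt (B.escape D p D' v w)| ≤ η * Real.sqrt (B.escape D p D' u w)

/-! ### Regularity vocabulary -/

/-- The `k`-**jet at the driving value** of the coordinate change to the hull subdomain `D'`:
`ψ^{(k)}(W)` for `ψ = transferAux D p D'` (Lawler–Schramm–Werner's `h_t'(W_t)`, `h_t''(W_t)`,
`h_t'''(W_t)`, the quantities entering `d[h_t'(W_t)^α]`).
[cite: LawlerSchrammWerner2003Restriction, §5] -/
def jet (D : DobrushinDomain) (p : CurveClass ℂ) (D' : DobrushinDomain) (k : ℕ) : ℝ :=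
  iteratedDeriv k (B.transferAux D p D') (B.W D p)

/-- The coordinate change to the hull subdomain `D'` is **`C^n`** (`n : WithTop ℕ∞`, `ω` =
analytic allowed) on the coordinates of boundary points untouched by the removed hulls (an open
set containing the slit sides and `W`; for conformal maps `h_t` is real-analytic there by Schwarz
reflection). [cite: LawlerSchrammWerner2003Restriction, §5] -/
def IsSmoothTransfer (n : WithTop ℕ∞) (D : DobrushinDomain) (p : CurveClass ℂ)
    (D' : DobrushinDomain) : Prop :=
  ContDiffOn ℝ n (B.transferAux D p D') {x : ℝ | B.β D p x ∉ closure (D.carrier \ D'.carrier)}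

/-- **Non-degenerate 3-jets over hulls** at the configuration `(D, p)`: the jets
`(ψ'(W), ψ''(W), ψ'''(W))` of the `C³` coordinate changes to hull subdomains fill a subset of
`ℝ³` with nonempty interior (so that an identity in these jets valid for all hulls forces its
coefficients to vanish — the step "LSW 2003 Prop. 5.3 read backwards" of the card, P2(b)).
[cite: LawlerSchrammWerner2003Restriction, §5 (Prop. 15 of the arXiv version)] -/
def HasNondegenerateJets (D : DobrushinDomain) (p : CurveClass ℂ) : Prop :=
  (interior {j : ℝ × ℝ × ℝ | ∃ D' : DobrushinDomain, D.IsHullSubdomain p D' ∧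
      B.IsSmoothTransfer 3 D p D' ∧ j = (B.jet D p D' 1, B.jet D p D' 2, B.jet D p D' 3)}).Nonempty

/-- The real coordinate of the boundary point `D.boundary t` of `∂D` (the Ptolemy coordinate as a
function of the boundary parameter of `D`; meaningful for `t` in the open window
`(D.mark 1, D.mark 1 + 1)` between the two occurrences of `b`, off the base-point parameter
`D.mark 0 + 1` in explored configurations). [folklore] -/
def coordOfParam (D : DobrushinDomain) (p : CurveClass ℂ) (t : ℝ) : ℝ :=
  invFunOn (B.βr D p) univ (D.boundary t)

/-- The Ptolemy coordinate is **`C^n` along `∂D` away from the growth point**: `t ↦ θ(D.boundary t)`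
is `C^n` on the parameter window minus the parameter `D.mark 0 + 1` of the base point `a`
(a condition relating the data to the given parametrisation of `∂D`; sensible for piecewise
smooth `∂D`, e.g. it fails at corners, where conformal coordinates have power singularities).
[folklore] -/
def IsSmoothCoordinate (n : WithTop ℕ∞) (D : DobrushinDomain) (p : CurveClass ℂ) : Prop :=
  ContDiffOn ℝ n (B.coordOfParam D p) (Ioo (D.mark 1) (D.mark 1 + 1) \ {D.mark 0 + 1})

/-- The Ptolemy coordinate has a **singularity of finite order at the growth point**: its
derivatives of order `≤ 3` along `∂D` grow at most polynomially in `|t − t₀|⁻¹` at the base-point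
parameter `t₀ = D.mark 0 + 1` (e.g. a power singularity `(t − t₀)^{π/α}` at a boundary corner of
opening `α` at `a`). [folklore] -/
def HasFiniteOrderTip (D : DobrushinDomain) (p : CurveClass ℂ) : Prop :=
  ∃ (C : ℝ) (N : ℕ), ∀ t ∈ Ioo (D.mark 1) (D.mark 1 + 1), t ≠ D.mark 0 + 1 →
    ∀ k ≤ 3, |iteratedDeriv k (B.coordOfParam D p) t| ≤ C * |t - (D.mark 0 + 1)|⁻¹ ^ N

end PtolemyBoundaryData

end Literature.Probability.RandomPlanarGeometry
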